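import Summits.Parity.GeneralizedHardyLittlewood.Theses.LiouvilleShiftedTables

/-!
# `TypeI2Dilated` (stmt-Parity-14272): the inner double sum is a `τ_S`-weighted single sum (refuter, support)

Support file for the crux `Summit.Parity.GeneralizedHardyLittlewood.Theses.LiouvilleShiftedTables.TypeI2Dilated`.
`inner_eq_tau_weighted`: for `r ≥ 1`,
`∑_{s ≤ S} ∑_{n ≤ y/(sr), rsn ≡ w (q)} G(r s n) = ∑_{t ≤ y/r, rt ≡ w (q)} τ_S(t) · G(r t)` with
`τ_S(t) = #{s ≤ S : s ∣ t}` (`tauTrunc`) — the summand and the class condition depend on `(s, n)`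
only through `s n`. First line of every treatment of X2 (Fouvry–Tenenbaum (5.5); the hyperbola
reduction that makes the level hypothesis `S R ≤ x^{1/2+ρ}` removable; the disprover's numerics).
-/

namespace Summit.Parity.GeneralizedHardyLittlewood.Cruxes.TypeI2Dilated.Negative

open Finset Real

/-- The truncated divisor function `τ_S(t) = #{s ≤ S : s ∣ t}` (here `S : ℕ`). -/
def tauTrunc (S t : ℕ) : ℕ := ((Finset.Icc 1 S).filter (fun s => s ∣ t)).card

/-- Floors compose: `⌊y/(s r)⌋ = ⌊y/r⌋ / s` for `s ≥ 1`. [folklore] -/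
theorem floor_div_mul_eq (y : ℝ) (s r : ℕ) :
    ⌊y / (s * r)⌋₊ = ⌊y / r⌋₊ / s := by
  rw [← Nat.floor_div_natCast, div_div, mul_comm (r : ℝ)]

/-- **The inner double sum is a `τ_S`-weighted single sum.** For `r ≥ 1` and any `G`,
`∑_{s ≤ S} ∑_{n ≤ y/(sr), rsn ≡ w (q)} G(r s n) = ∑_{t ≤ y/r, rt ≡ w (q)} τ_S(t) · G(r t)`
(re-index `t = s n`; the summand and the class condition depend on `(s, n)` only through `s n`).
This is the first line of every treatment (Fouvry–Tenenbaum (5.5); the numerics of this cycle). -/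
theorem inner_eq_tau_weighted (G : ℕ → ℝ) (q w r : ℕ) (S : ℕ) (y : ℝ) :
    ∑ s ∈ Finset.Icc 1 S,
        ∑ n ∈ (Finset.Icc 1 ⌊y / (s * r)⌋₊).filter (fun n : ℕ => r * s * n ≡ w [MOD q]),
          G (r * s * n) =
      ∑ t ∈ (Finset.Icc 1 ⌊y / r⌋₊).filter (fun t : ℕ => r * t ≡ w [MOD q]),
        (tauTrunc S t : ℝ) * G (r * t) := by
  classical
  set T := ⌊y / r⌋₊ with hT
  set D := (Finset.Icc 1 T).filter (fun t : ℕ => r * t ≡ w [MOD q]) with hD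
  -- Step 1: for each `s ≥ 1`, re-index `n ↦ t = s n`
  have hstep : ∀ s ∈ Finset.Icc 1 S,
      ∑ n ∈ (Finset.Icc 1 ⌊y / (s * r)⌋₊).filter (fun n : ℕ => r * s * n ≡ w [MOD q]),
          G (r * s * n) = ∑ t ∈ D, if s ∣ t then G (r * t) else 0 := by
    intro s hs
    rw [Finset.mem_Icc] at hs
    have hs0 : 0 < s := hs.1
    rw [floor_div_mul_eq, ← hT]
    -- the filtered `n`-set maps injectively onto `{t ∈ D | s ∣ t}` under `n ↦ s n`
    rw [← Finset.sum_filter]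
    symm
    refine Finset.sum_bij' (fun t _ => t / s) (fun n _ => s * n) ?_ ?_ ?_ ?_ ?_
    · intro t ht
      rw [Finset.mem_filter, hD, Finset.mem_filter, Finset.mem_Icc] at ht
      obtain ⟨⟨⟨ht1, htT⟩, hclass⟩, hdiv⟩ := ht
      rw [Finset.mem_filter, Finset.mem_Icc]
      refine ⟨⟨Nat.div_pos (Nat.le_of_dvd (by omega) hdiv) hs0, Nat.div_le_div_right htT⟩, ?_⟩
      rwa [mul_assoc, Nat.mul_div_cancel' hdiv]
    · intro n hn
      rw [Finset.mem_filter, Finset.mem_Icc] at hn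
      obtain ⟨⟨hn1, hnT⟩, hclass⟩ := hn
      rw [Finset.mem_filter, hD, Finset.mem_filter, Finset.mem_Icc]
      refine ⟨⟨⟨?_, ?_⟩, ?_⟩, Dvd.intro n rfl⟩
      · calc 1 ≤ n := hn1
          _ ≤ s * n := Nat.le_mul_of_pos_left n hs0
      · have := (Nat.le_div_iff_mul_le hs0).1 hnT
        rw [mul_comm] at this
        exact this
      · rwa [← mul_assoc]
    · intro t ht
      rw [Finset.mem_filter] at ht
      exact Nat.mul_div_cancel' ht.2
    · intro n _
      exact Nat.mul_div_cancel_left n hs0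
    · intro t ht
      rw [Finset.mem_filter] at ht
      rw [mul_assoc, Nat.mul_div_cancel' ht.2]
  rw [Finset.sum_congr rfl hstep, Finset.sum_comm]
  refine Finset.sum_congr rfl fun t _ => ?_
  rw [Finset.sum_ite, Finset.sum_const_zero, add_zero, Finset.sum_const, nsmul_eq_mul]
  rfl

end Summit.Parity.GeneralizedHardyLittlewood.Cruxes.TypeI2Dilated.Negative
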